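import Summits.ResolutionOfSingularities.ResolutionOfSingularities.Theorems.FrobeniusLadderFInjectiveMacaulayficationT11PlusPrime
import Mathlib.RingTheory.MvPolynomial.Basic
import Mathlib.RingTheory.Ideal.Quotient.Operations
import HarnessLib

/-!
# W4.5a U4: the hypersurface `T₁₁ = V(z² + (y²+x³)³ + x¹¹ + w⁷) ⊂ 𝔸⁴` is INTEGRAL, and no coordinate vanishes on it

Support file for crux stmt-ResolutionOfSingularities-15315 (`FrobeniusLadder.FInjectiveMacaulayfication`), chain w45a — item U4
`T11HypersurfacePrime` of res-L1-w45a-plan-1's UNCLAIMED-STUB LIST v1 (2026-08-27T09:02:12Z), dealt to res-type-003 by res-plan-2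
IDLE POOL DEAL #5c (09:06:21Z). [OURS · L1 W4.5a] — NOT a statement of the manuscript [claim: Hironaka2017]; AI-written, weaker than
expert review.

Variables `(x, y, z, w) = (X 0, X 1, X 2, X 3)` of `k[X] = MvPolynomial (Fin 4) k`; `g = z² + (y² + x³)³ + x¹¹ + w⁷` (the specimen
`T₁₁` itself, WITHOUT the key variable `Φ` of the re-embedding `T₁₁⁺ ⊂ 𝔸⁵` treated in `…T11PlusPrime`). Over EVERY field `k`:

* `prime_T11_four` — `g` is prime and divides no variable: `k[X₀..X₃] ≃ k[Y₀,Y₁,Y₂][T]`, `z ↦ T`, `g ↦ T² + C c` with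
  `c = (Y₁²+Y₀³)³ + Y₀¹¹ + Y₂⁷`, and `−c` is a non-square since it specialises to `−T⁷` under `Y ↦ (0, 0, −T)`
  (`E8Forms.prime_and_not_dvd_of_ringEquiv`, odd-degree test `T11PlusPrime.mul_self_ne_neg_of_aeval'`) — the four-variable
  twin of `T11PlusPrime.prime_T11_five`;
* `isPrime_span_T11`, `mk_X_ne_zero_T11` — `(g)` is a prime ideal and `x̄ᵥ ≠ 0` in `k[X]/(g)` for every `v`;
* `t11_prime_and_X_ne_zero` — packaged for `Fs = ![g]` (`Ideal.span (Set.range Fs)`), the binders `hprime` / `hXne` of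
  `CICertificates.ciCertificates` for the `T₁₁/7` instance.

No definitions, no named facts. [folklore]
-/

-- single-problem summit: the doubled namespace component is forced
set_option linter.dupNamespace false

noncomputable section

namespace Summit.ResolutionOfSingularities.ResolutionOfSingularities.Theorems.FInjectiveMacaulayfication.T11HypersurfacePrime

open MvPolynomial Polynomial
open Summit.ResolutionOfSingularities.ResolutionOfSingularities.Theorems.FInjectiveMacaulayfication

variable (k : Type) [Field k]

/-! ## §1 `g = z² + (y²+x³)³ + x¹¹ + w⁷` is prime in `k[x,y,z,w]` -/

/-- **`g = z² + (y²+x³)³ + x¹¹ + w⁷` is prime in `k[x,y,z,w]` and divides no variable** (any field `k`). Route: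
`k[X₀..X₃] ≃ k[Y₀,Y₁,Y₂][T]` with `X 2 ↦ T` (reindexing by the swaps `(0 2)(1 2)`, then `finSuccEquiv`), `g ↦ T² + C c`, `−c` a
non-square by the specialisation `Y ↦ (0, 0, −T)` (`c ↦ −T⁷`). [folklore] -/
-- adapted from `T11PlusPrime.prime_T11_five` (the five-variable re-embedded specimen)
theorem prime_T11_four (g : MvPolynomial (Fin 4) k)
    (hg : g = MvPolynomial.X 2 ^ 2 + (MvPolynomial.X 1 ^ 2 + MvPolynomial.X 0 ^ 3) ^ 3 + MvPolynomial.X 0 ^ 11 +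
      MvPolynomial.X 3 ^ 7) :
    Prime g ∧ ∀ v : Fin 4, ¬ g ∣ MvPolynomial.X v := by
  -- the reindexing `σ : Fin 4 ≃ Fin 4` with `σ 2 = 0`, `σ 0 = 1`, `σ 1 = 2`, `σ 3 = 3`
  let σ : Fin 4 ≃ Fin 4 := (Equiv.swap (0 : Fin 4) 2).trans (Equiv.swap (1 : Fin 4) 2)
  have hσ2 : σ 2 = 0 := by decide
  have hσ0 : σ 0 = 1 := by decide
  have hσ1 : σ 1 = 2 := by decide
  have hσ3 : σ 3 = 3 := by decide
  obtain ⟨e, he0, he1, he2, he3⟩ : ∃ e : MvPolynomial (Fin 4) k ≃+* Polynomial (MvPolynomial (Fin 3) k),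
      e (MvPolynomial.X 0) = Polynomial.C (MvPolynomial.X 0) ∧ e (MvPolynomial.X 1) = Polynomial.C (MvPolynomial.X 1) ∧
        e (MvPolynomial.X 2) = Polynomial.X ∧ e (MvPolynomial.X 3) = Polynomial.C (MvPolynomial.X 2) := by
    refine ⟨((MvPolynomial.renameEquiv k σ).trans (MvPolynomial.finSuccEquiv k 3)).toRingEquiv, ?_, ?_, ?_, ?_⟩
    · show MvPolynomial.finSuccEquiv k 3 (MvPolynomial.rename σ (MvPolynomial.X 0)) = _
      rw [MvPolynomial.rename_X, hσ0]; exact MvPolynomial.finSuccEquiv_X_succ (j := 0)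
    · show MvPolynomial.finSuccEquiv k 3 (MvPolynomial.rename σ (MvPolynomial.X 1)) = _
      rw [MvPolynomial.rename_X, hσ1]; exact MvPolynomial.finSuccEquiv_X_succ (j := 1)
    · show MvPolynomial.finSuccEquiv k 3 (MvPolynomial.rename σ (MvPolynomial.X 2)) = _
      rw [MvPolynomial.rename_X, hσ2]; exact MvPolynomial.finSuccEquiv_X_zero
    · show MvPolynomial.finSuccEquiv k 3 (MvPolynomial.rename σ (MvPolynomial.X 3)) = _
      rw [MvPolynomial.rename_X, hσ3]; exact MvPolynomial.finSuccEquiv_X_succ (j := 2)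
  set c : MvPolynomial (Fin 3) k := (MvPolynomial.X 1 ^ 2 + MvPolynomial.X 0 ^ 3) ^ 3 + MvPolynomial.X 0 ^ 11 +
    MvPolynomial.X 2 ^ 7 with hc_def
  have hef : e g = Polynomial.X ^ 2 + Polynomial.C c := by
    subst hg
    simp only [map_add, map_pow, he0, he1, he2, he3, hc_def]
    ring
  -- `-c` is a non-square: specialise `Y₀, Y₁ ↦ 0`, `Y₂ ↦ -T`
  have hc : ∀ a : MvPolynomial (Fin 3) k, a * a ≠ -c :=
    T11PlusPrime.mul_self_ne_neg_of_aeval' k ![0, 0, -Polynomial.X] 3 (by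
      rw [hc_def]
      simp only [map_add, map_pow, MvPolynomial.aeval_X, Matrix.cons_val_zero, Matrix.cons_val_one, Matrix.cons_val]
      ring)
  obtain ⟨hp, hnd⟩ := E8Forms.prime_and_not_dvd_of_ringEquiv e g c hef hc
  refine ⟨hp, fun v => ?_⟩
  fin_cases v
  · exact hnd (MvPolynomial.X 0) (MvPolynomial.X 0) (MvPolynomial.X_ne_zero 0) he0
  · exact hnd (MvPolynomial.X 1) (MvPolynomial.X 1) (MvPolynomial.X_ne_zero 1) he1
  · rintro ⟨q, hq⟩
    have h1 : (Polynomial.X ^ 2 + Polynomial.C c : Polynomial (MvPolynomial (Fin 3) k)) ∣ Polynomial.X :=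
      ⟨e q, by rw [← hef, ← map_mul, ← hq]; exact he2.symm⟩
    have h2 := Polynomial.natDegree_le_of_dvd h1 Polynomial.X_ne_zero
    rw [Polynomial.natDegree_X_pow_add_C, Polynomial.natDegree_X] at h2
    omega
  · exact hnd (MvPolynomial.X 3) (MvPolynomial.X 2) (MvPolynomial.X_ne_zero 2) he3

/-! ## §2 `(g)` is a prime ideal and no coordinate vanishes modulo `g` -/

/-- **`(g)` is a prime ideal of `k[x,y,z,w]`** for `g = z² + (y²+x³)³ + x¹¹ + w⁷`, over every field `k`: the hypersurface `T₁₁`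
is integral. [folklore] -/
theorem isPrime_span_T11 (g : MvPolynomial (Fin 4) k)
    (hg : g = MvPolynomial.X 2 ^ 2 + (MvPolynomial.X 1 ^ 2 + MvPolynomial.X 0 ^ 3) ^ 3 + MvPolynomial.X 0 ^ 11 +
      MvPolynomial.X 3 ^ 7) :
    (Ideal.span ({g} : Set (MvPolynomial (Fin 4) k))).IsPrime := by
  obtain ⟨hp, -⟩ := prime_T11_four k g hg
  exact (Ideal.span_singleton_prime hp.ne_zero).mpr hp

/-- **No coordinate vanishes on `T₁₁`**: `x̄ᵥ ≠ 0` in `k[x,y,z,w]/(g)` for every `v` (the prime `g` divides no variable).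
[folklore] -/
theorem mk_X_ne_zero_T11 (g : MvPolynomial (Fin 4) k)
    (hg : g = MvPolynomial.X 2 ^ 2 + (MvPolynomial.X 1 ^ 2 + MvPolynomial.X 0 ^ 3) ^ 3 + MvPolynomial.X 0 ^ 11 +
      MvPolynomial.X 3 ^ 7) (v : Fin 4) :
    Ideal.Quotient.mk (Ideal.span ({g} : Set (MvPolynomial (Fin 4) k))) (MvPolynomial.X v) ≠ 0 := by
  obtain ⟨-, hX⟩ := prime_T11_four k g hg
  rw [Ne, Ideal.Quotient.eq_zero_iff_mem, Ideal.mem_span_singleton]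
  exact hX v

/-! ## §3 Packaged for `Fs = ![g]` -/

/-- **`T₁₁` inputs `hprime` and `hXne` of `CICertificates.ciCertificates`**: for `Fs = ![z² + (y²+x³)³ + x¹¹ + w⁷]` over any
field, `Ideal.span (Set.range Fs)` is prime and every `x̄ᵥ ≠ 0`. [folklore] -/
theorem t11_prime_and_X_ne_zero (Fs : Fin 1 → MvPolynomial (Fin 4) k)
    (hF : Fs 0 = MvPolynomial.X 2 ^ 2 + (MvPolynomial.X 1 ^ 2 + MvPolynomial.X 0 ^ 3) ^ 3 + MvPolynomial.X 0 ^ 11 +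
      MvPolynomial.X 3 ^ 7) :
    (Ideal.span (Set.range Fs)).IsPrime ∧
      ∀ v : Fin 4, Ideal.Quotient.mk (Ideal.span (Set.range Fs)) (MvPolynomial.X v) ≠ 0 := by
  have hrange : Set.range Fs = {Fs 0} := by
    ext q
    simp only [Set.mem_range, Set.mem_singleton_iff]
    constructor
    · rintro ⟨i, rfl⟩
      obtain rfl : i = 0 := Subsingleton.elim i 0
      rfl
    · rintro rfl
      exact ⟨0, rfl⟩
  rw [hrange]
  exact ⟨isPrime_span_T11 k (Fs 0) hF, mk_X_ne_zero_T11 k (Fs 0) hF⟩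

end Summit.ResolutionOfSingularities.ResolutionOfSingularities.Theorems.FInjectiveMacaulayfication.T11HypersurfacePrime

end
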